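import Literature.NumberTheory.EllipticCurves.PAdicLFunctionInterpolationProofs
import HarnessLib

/-!
# Route `ThetaPartnerAtTwo` (TP2), crux K3 `SignedKatoDivisibilityUpToAtTwo` (stmt-BirchSwinnertonDyer-20308 / K3P′ 25631), line
# `colemanrat` v12 — ODD PRIMITIVE CHARACTERS modulo `2^e`: an explicit injective family of size `2^{e−3}` (input of the odd-twist supply
# for the cusp-factor generation argument)

Width seat `bsd-wall-tp2-p2x-w2` g6 (cell `bsd-wall`). HONEST FRAMING: theorems only (no definition, no named fact, no instance, no
`sorry`); elementary character theory of `(ℤ/2^e)^×` over any field; closes no item; K3 / K3P′ are NOT settled and BSD is NOT proved by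
any of this.

## Why (memo `Cruxes/SignedKatoDivisibilityUpToAtTwo/W2G6-KATO1312-AT2.md` §1 (d), §2; prequel `…CuspFactorSpan.lean`, sequel
## `…CuspFactorOddTwistSupply.lean`)

The K3 assembly reads Kato's explicit reciprocity law at `2` character by character; its `μ ∈ Λ ∖ 𝔭` is the rational four-term cusp
factor built from the MINUS modular symbols `[b/2^e]⁻_f` (Kato, Astérisque 295, Thm. 6.6 with the parity cross-over). The prequel
(`CuspSpan.exists_bracket_ne_zero`) reduces «some `(c,d)` has `μ̃ ∉ 𝔭`» at the exceptional primes to THREE distinct characters `ψ` of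
`(ℤ/2^e)^×` with `∑_b ψ(b)[b/2^e]⁻_f ≠ 0`; the sequel gets them from Rohrlich's theorem (= Kato's Thm. 13.5 (2), used in §13.12 with
«a power `A` of `p` and `ν` of conductor `A`») once there are MANY odd primitive characters of conductor `2^e`. THIS FILE supplies them
(any field `K` with `2 ≠ 0` and enough `φ(2^e)`-th roots of unity; `e ≥ 3`): the element `u = 5^{2^{e−3}}` of `ℤ/2^e` (`≠ ±1`, `u² = 1`,
`u ≡ 1` modulo every proper divisor of `2^e` — from the tree's `orderOf_cyclotomicGenerator`), the PRIMITIVITY CRITERION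
`χ(u) ≠ 1 ⟹ χ` primitive (`isPrimitive_of_apply_ne_one`), characters by finite-abelian-group duality (Mathlib
`CommGroup.exists_apply_ne_one_of_hasEnoughRootsOfUnity`), and the family `β·ψ₀^{2j}`, `0 ≤ j < 2^{e−3}` (`β` odd with `β(u) = −1`,
`ψ₀` even with `ψ₀(u) ≠ 1`): odd, primitive, pairwise distinct (`exists_odd_isPrimitive_family`). (There are exactly `2^{e−3}` odd
primitive characters modulo `2^e`; only the lower bound is needed.)

References: [Washington1997] L. Washington, *Introduction to Cyclotomic Fields*, §7.2 (characters of `(ℤ/2^e)^×`); [Kato2004Asterisque]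
K. Kato, Astérisque 295 (2004), Thm. 13.5 (2) (p. 227), §13.12 (pp. 231–233).
-/

set_option autoImplicit false
-- the Theorems namespace of this sub repeats the summit name by design (D-0017 nested layout)
set_option linter.dupNamespace false

noncomputable section

open scoped BigOperators

open Literature.NumberTheory.EllipticCurves

namespace Summit.BirchSwinnertonDyer.BirchSwinnertonDyer.Theorems.SignedKatoOffTwo.OddTwistSupply

/-! ## §1 Characters of `(ℤ/2^e)^×`: the element `u = 5^{2^{e−3}}`, a primitivity criterion, an odd primitive family -/

section Characters

variable (K : Type*) [Field K]

/-- `5^{2^{e−3}} ≠ 1` in `ℤ/2^e` (`e ≥ 3`): `5` has order `2^{e−2}` modulo `2^e` (tree `orderOf_cyclotomicGenerator`,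
`γ_cyc = 5`, `e₀ = 2`). [cite: Washington1997, §7.2] -/
theorem five_pow_ne_one {e : ℕ} (he : 3 ≤ e) : (5 : ZMod (2 ^ e)) ^ 2 ^ (e - 3) ≠ 1 := by
  obtain ⟨k, rfl⟩ : ∃ k, e = k + 3 := ⟨e - 3, by omega⟩
  have hord : orderOf ((cyclotomicGenerator 2 : ℕ) : ZMod (2 ^ (k + 1 + cyclotomicExponent 2))) = 2 ^ (k + 1) :=
    orderOf_cyclotomicGenerator 2 (k + 1)
  have hce : cyclotomicExponent 2 = 2 := rfl
  have hγ : cyclotomicGenerator 2 = 5 := rfl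
  rw [hγ, hce, show k + 1 + 2 = k + 3 from rfl] at hord
  rw [show k + 3 - 3 = k from by omega]
  intro h
  have h5 : ((5 : ℕ) : ZMod (2 ^ (k + 3))) ^ 2 ^ k = 1 := by exact_mod_cast h
  have hdvd := orderOf_dvd_of_pow_eq_one h5
  rw [hord, Nat.pow_dvd_pow_iff_le_right (by norm_num)] at hdvd
  omega

/-- `(5^{2^{e−3}})² = 5^{2^{e−2}} = 1` in `ℤ/2^e` (`e ≥ 3`). [cite: Washington1997, §7.2] -/
theorem five_pow_sq_eq_one {e : ℕ} (he : 3 ≤ e) : ((5 : ZMod (2 ^ e)) ^ 2 ^ (e - 3)) ^ 2 = 1 := by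
  obtain ⟨k, rfl⟩ : ∃ k, e = k + 3 := ⟨e - 3, by omega⟩
  have hord : orderOf ((cyclotomicGenerator 2 : ℕ) : ZMod (2 ^ (k + 1 + cyclotomicExponent 2))) = 2 ^ (k + 1) :=
    orderOf_cyclotomicGenerator 2 (k + 1)
  have hce : cyclotomicExponent 2 = 2 := rfl
  have hγ : cyclotomicGenerator 2 = 5 := rfl
  rw [hγ, hce, show k + 1 + 2 = k + 3 from rfl] at hord
  rw [show k + 3 - 3 = k from by omega, ← pow_mul, ← pow_succ]
  have h := pow_orderOf_eq_one ((5 : ℕ) : ZMod (2 ^ (k + 3)))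
  rw [hord] at h
  exact_mod_cast h

/-- `5^{2^{e−3}} ≡ 1` modulo every PROPER divisor `c` of `2^e` (`e ≥ 3`): such `c` divides `2^{e−1}` and `5` has order `2^{e−3}` modulo
`2^{e−1}`. [cite: Washington1997, §7.2] -/
theorem five_pow_cast_eq_one {e : ℕ} (he : 3 ≤ e) {c : ℕ} (hc : c ∣ 2 ^ e) (hce : c ≠ 2 ^ e) :
    (((5 ^ 2 ^ (e - 3) : ℕ) : ZMod (2 ^ e)).cast : ZMod c) = 1 := by
  obtain ⟨k, rfl⟩ : ∃ k, e = k + 3 := ⟨e - 3, by omega⟩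
  -- `c ∣ 2^(k+2)`
  obtain ⟨i, hi, rfl⟩ := (Nat.dvd_prime_pow Nat.prime_two).mp hc
  have hik : i ≤ k + 2 := by
    rcases Nat.lt_or_ge i (k + 3) with h | h
    · omega
    · exact absurd (le_antisymm hi h ▸ rfl) hce
  have hc' : 2 ^ i ∣ 2 ^ (k + 2) := Nat.pow_dvd_pow 2 hik
  rw [ZMod.cast_natCast hc, show k + 3 - 3 = k from by omega]
  -- at level `2^(k+2)` the power is `1`
  have hord : orderOf ((cyclotomicGenerator 2 : ℕ) : ZMod (2 ^ (k + cyclotomicExponent 2))) = 2 ^ k :=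
    orderOf_cyclotomicGenerator 2 k
  have hce2 : cyclotomicExponent 2 = 2 := rfl
  have hγ : cyclotomicGenerator 2 = 5 := rfl
  rw [hγ, hce2] at hord
  have h1 : ((5 ^ 2 ^ k : ℕ) : ZMod (2 ^ (k + 2))) = 1 := by
    have h := pow_orderOf_eq_one ((5 : ℕ) : ZMod (2 ^ (k + 2)))
    rw [hord] at h
    exact_mod_cast h
  have h2 := congrArg (ZMod.castHom hc' (ZMod (2 ^ i))) h1
  rwa [map_natCast, map_one] at h2

/-- `5^{2^{e−3}} ≠ −1` in `ℤ/2^e` (`e ≥ 3`): reduce modulo `4` (`5 ≡ 1`, `−1 ≢ 1`). [cite: Washington1997, §7.2] -/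
theorem five_pow_ne_neg_one {e : ℕ} (he : 3 ≤ e) : (5 : ZMod (2 ^ e)) ^ 2 ^ (e - 3) ≠ -1 := by
  intro h
  have h4 : (4 : ℕ) ∣ 2 ^ e := ⟨2 ^ (e - 2), by rw [show (4 : ℕ) = 2 ^ 2 by norm_num, ← pow_add]; congr 1; omega⟩
  have h' := congrArg (ZMod.castHom h4 (ZMod 4)) h
  rw [map_pow, map_neg, map_one, map_ofNat] at h'
  have h5 : ((5 : ZMod 4)) ^ 2 ^ (e - 3) = 1 := by
    rw [show (5 : ZMod 4) = 1 from by decide, one_pow]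
  rw [h5] at h'
  exact absurd h' (by decide)

/-- **Primitivity criterion at `2`.** A Dirichlet character `χ` modulo `2^e` (`e ≥ 3`, any field) with `χ(5^{2^{e−3}}) ≠ 1` is
PRIMITIVE: otherwise it factors through its conductor `c`, a proper divisor of `2^e`, and `5^{2^{e−3}} ≡ 1 (mod c)`.
[cite: Washington1997, §7.2] -/
theorem isPrimitive_of_apply_ne_one {e : ℕ} (he : 3 ≤ e) (χ : DirichletCharacter K (2 ^ e))
    (hχ : χ (((5 ^ 2 ^ (e - 3) : ℕ) : ZMod (2 ^ e))) ≠ 1) : χ.IsPrimitive := by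
  haveI : NeZero (2 ^ e) := ⟨pow_ne_zero _ two_ne_zero⟩
  by_contra hprim
  rw [DirichletCharacter.isPrimitive_def] at hprim
  obtain ⟨hc, χ₀, hχ₀⟩ := χ.factorsThrough_conductor
  have hcop : Nat.Coprime (5 ^ 2 ^ (e - 3)) (2 ^ e) :=
    Nat.Coprime.pow _ _ (by norm_num)
  apply hχ
  rw [← ZMod.coe_unitOfCoprime _ hcop, hχ₀, DirichletCharacter.changeLevel_eq_cast_of_dvd χ₀ hc, ZMod.coe_unitOfCoprime,
    five_pow_cast_eq_one he hc hprim, map_one]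

/-- **Duality.** For a unit `x ≠ 1` of `ℤ/2^e` there is a Dirichlet character `χ` modulo `2^e` with values in `K` (a field with enough
`φ(2^e)`-th roots of unity) with `χ(x) ≠ 1` (Mathlib `CommGroup.exists_apply_ne_one_of_hasEnoughRootsOfUnity`). [folklore] -/
theorem exists_apply_ne_one {e : ℕ} [HasEnoughRootsOfUnity K (Nat.totient (2 ^ e))] (x : (ZMod (2 ^ e))ˣ) (hx : x ≠ 1) :
    ∃ χ : DirichletCharacter K (2 ^ e), χ x ≠ 1 := by
  classical
  haveI : NeZero (2 ^ e) := ⟨pow_ne_zero _ two_ne_zero⟩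
  have hexp : Monoid.exponent (ZMod (2 ^ e))ˣ ∣ Nat.totient (2 ^ e) := by
    rw [← ZMod.card_units_eq_totient]
    exact Group.exponent_dvd_card
  haveI : NeZero (Nat.totient (2 ^ e)) := ⟨(Nat.totient_pos.mpr (NeZero.pos _)).ne'⟩
  haveI : HasEnoughRootsOfUnity K (Monoid.exponent (ZMod (2 ^ e))ˣ) := HasEnoughRootsOfUnity.of_dvd K hexp
  obtain ⟨φ, hφ⟩ := CommGroup.exists_apply_ne_one_of_hasEnoughRootsOfUnity (ZMod (2 ^ e))ˣ K hx
  refine ⟨MulChar.ofUnitHom φ, fun h ↦ hφ ?_⟩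
  rw [MulChar.ofUnitHom_coe] at h
  exact Units.ext h

/-- **An EVEN character non-trivial at `u`.** For `e ≥ 3` there is an even Dirichlet character `ψ₀` modulo `2^e` with `ψ₀(5^{2^{e−3}}) ≠ 1`:
duality for `(ℤ/2^e)^× / {±1}`, where the class of `u = 5^{2^{e−3}}` is non-trivial (`u ≠ ±1`). (Cf. the tree's
`exists_isPrimitive_even_orderOf_eq_prime_pow`, same construction with `u = 1 + 2^{e−1}`.) [cite: Washington1997, §7.2] -/
theorem exists_even_apply_ne_one {e : ℕ} (he : 3 ≤ e) [HasEnoughRootsOfUnity K (Nat.totient (2 ^ e))] :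
    ∃ ψ₀ : DirichletCharacter K (2 ^ e), ψ₀.Even ∧ ψ₀ (((5 ^ 2 ^ (e - 3) : ℕ) : ZMod (2 ^ e))) ≠ 1 := by
  classical
  haveI : NeZero (2 ^ e) := ⟨pow_ne_zero _ two_ne_zero⟩
  let T : Subgroup (ZMod (2 ^ e))ˣ :=
    { carrier := {x | x = 1 ∨ x = -1}
      mul_mem' := by
        rintro x y (rfl | rfl) (rfl | rfl) <;> simp
      one_mem' := Or.inl rfl
      inv_mem' := by
        rintro x (rfl | rfl) <;> simp }
  have hT : ∀ x : (ZMod (2 ^ e))ˣ, x ∈ T ↔ x = 1 ∨ x = -1 := fun x ↦ Iff.rfl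
  have hcop : Nat.Coprime (5 ^ 2 ^ (e - 3)) (2 ^ e) := Nat.Coprime.pow _ _ (by norm_num)
  let u : (ZMod (2 ^ e))ˣ := ZMod.unitOfCoprime _ hcop
  have hu : (u : ZMod (2 ^ e)) = (5 : ZMod (2 ^ e)) ^ 2 ^ (e - 3) := by
    rw [ZMod.coe_unitOfCoprime]; push_cast; rfl
  have huT : u ∉ T := by
    rw [hT, Units.ext_iff, Units.ext_iff, hu, Units.val_one, Units.val_neg, Units.val_one]
    rintro (h | h)
    · exact five_pow_ne_one he h
    · exact five_pow_ne_neg_one he h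
  have hmk : (QuotientGroup.mk u : (ZMod (2 ^ e))ˣ ⧸ T) ≠ 1 := by
    rwa [Ne, QuotientGroup.eq_one_iff]
  have hexp : Monoid.exponent ((ZMod (2 ^ e))ˣ ⧸ T) ∣ Nat.totient (2 ^ e) := by
    rw [Monoid.exponent_dvd_iff_forall_pow_eq_one]
    intro q
    induction q using QuotientGroup.induction_on with
    | H x => rw [← QuotientGroup.mk_pow, ZMod.pow_totient, QuotientGroup.mk_one]
  haveI : NeZero (Nat.totient (2 ^ e)) := ⟨(Nat.totient_pos.mpr (NeZero.pos _)).ne'⟩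
  haveI : HasEnoughRootsOfUnity K (Monoid.exponent ((ZMod (2 ^ e))ˣ ⧸ T)) := HasEnoughRootsOfUnity.of_dvd K hexp
  obtain ⟨φ, hφ⟩ := CommGroup.exists_apply_ne_one_of_hasEnoughRootsOfUnity ((ZMod (2 ^ e))ˣ ⧸ T) K hmk
  let g : (ZMod (2 ^ e))ˣ →* Kˣ := φ.comp (QuotientGroup.mk' T)
  refine ⟨MulChar.ofUnitHom g, ?_, ?_⟩
  · show MulChar.ofUnitHom g ((-1 : ZMod (2 ^ e))) = 1
    rw [← Units.coe_neg_one, MulChar.ofUnitHom_coe]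
    have : g (-1) = 1 := by
      show φ (QuotientGroup.mk' T (-1)) = 1
      rw [QuotientGroup.mk'_apply, (QuotientGroup.eq_one_iff _).mpr (Or.inr rfl), map_one]
    rw [this, Units.val_one]
  · have h5 : (((5 ^ 2 ^ (e - 3) : ℕ) : ZMod (2 ^ e))) = (u : ZMod (2 ^ e)) := by rw [hu]; push_cast; rfl
    rw [h5, MulChar.ofUnitHom_coe]
    intro h
    apply hφ
    exact Units.ext h

/-- Values of a character at an element of order dividing `2` are `±1`. [folklore] -/
theorem apply_eq_one_or_eq_neg_one {n : ℕ} (χ : DirichletCharacter K n) {x : ZMod n} (hx : x ^ 2 = 1) :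
    χ x = 1 ∨ χ x = -1 := by
  have h : χ x ^ 2 = 1 := by rw [← map_pow, hx, map_one]
  have h2 : (χ x - 1) * (χ x + 1) = 0 := by linear_combination h
  rcases mul_eq_zero.mp h2 with h3 | h3
  · exact Or.inl (by linear_combination h3)
  · exact Or.inr (by linear_combination h3)

/-- **An ODD character with `β(u) = −1`.** For `e ≥ 3` there is an odd Dirichlet character `β` modulo `2^e` with `β(5^{2^{e−3}}) = −1`:
combine a character non-trivial at `−1` and one non-trivial at `u` (both by duality; all values involved are `±1`).
[cite: Washington1997, §7.2] -/
theorem exists_odd_apply_eq_neg_one {e : ℕ} (he : 3 ≤ e) [HasEnoughRootsOfUnity K (Nat.totient (2 ^ e))] :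
    ∃ β : DirichletCharacter K (2 ^ e), β.Odd ∧ β (((5 ^ 2 ^ (e - 3) : ℕ) : ZMod (2 ^ e))) = -1 := by
  classical
  haveI : NeZero (2 ^ e) := ⟨pow_ne_zero _ two_ne_zero⟩
  have hcop : Nat.Coprime (5 ^ 2 ^ (e - 3)) (2 ^ e) := Nat.Coprime.pow _ _ (by norm_num)
  set u5 : ZMod (2 ^ e) := ((5 ^ 2 ^ (e - 3) : ℕ) : ZMod (2 ^ e)) with hu5
  have hu5' : u5 = (5 : ZMod (2 ^ e)) ^ 2 ^ (e - 3) := by rw [hu5]; push_cast; rfl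
  have husq : u5 ^ 2 = 1 := by rw [hu5']; exact five_pow_sq_eq_one he
  have hm1sq : (-1 : ZMod (2 ^ e)) ^ 2 = 1 := by rw [neg_one_sq]
  -- a character non-trivial at `-1`
  have hne1 : (-1 : (ZMod (2 ^ e))ˣ) ≠ 1 := by
    intro h
    have h' := congrArg (fun x : (ZMod (2 ^ e))ˣ ↦ (ZMod.castHom (show (4 : ℕ) ∣ 2 ^ e from
      ⟨2 ^ (e - 2), by rw [show (4 : ℕ) = 2 ^ 2 by norm_num, ← pow_add]; congr 1; omega⟩) (ZMod 4)) (x : ZMod (2 ^ e))) h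
    simp only [Units.val_neg, Units.val_one, map_neg, map_one] at h'
    exact absurd h' (by decide)
  obtain ⟨ω, hω⟩ := exists_apply_ne_one K (-1 : (ZMod (2 ^ e))ˣ) hne1
  rw [Units.val_neg, Units.val_one] at hω
  have hω1 : ω (-1) = -1 := (apply_eq_one_or_eq_neg_one K ω hm1sq).resolve_left hω
  -- a character non-trivial at `u`
  let u : (ZMod (2 ^ e))ˣ := ZMod.unitOfCoprime _ hcop
  have hu : (u : ZMod (2 ^ e)) = u5 := by rw [ZMod.coe_unitOfCoprime]
  have hune : u ≠ 1 := by
    intro h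
    have h' := congrArg (fun x : (ZMod (2 ^ e))ˣ ↦ (x : ZMod (2 ^ e))) h
    simp only [hu, hu5', Units.val_one] at h'
    exact five_pow_ne_one he h'
  obtain ⟨ρ, hρ⟩ := exists_apply_ne_one K u hune
  rw [hu] at hρ
  have hρu : ρ u5 = -1 := (apply_eq_one_or_eq_neg_one K ρ husq).resolve_left hρ
  -- casework
  rcases apply_eq_one_or_eq_neg_one K ω husq with hωu | hωu
  · rcases apply_eq_one_or_eq_neg_one K ρ hm1sq with hρ1 | hρ1
    · refine ⟨ω * ρ, ?_, ?_⟩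
      · show (ω * ρ) (-1) = -1
        rw [MulChar.mul_apply, hω1, hρ1, mul_one]
      · rw [MulChar.mul_apply, hωu, hρu, one_mul]
    · exact ⟨ρ, hρ1, hρu⟩
  · exact ⟨ω, hω1, hωu⟩

variable [NeZero (2 : K)]

/-- **An injective family of `2^{e−3}` odd primitive characters modulo `2^e`** (`e ≥ 3`; any field `K` with `2 ≠ 0` and enough
`φ(2^e)`-th roots of unity): `ψ_j = β·ψ₀^{2j}`, `0 ≤ j < 2^{e−3}`, with `β` odd, `β(u) = −1` and `ψ₀` even, `ψ₀(u) ≠ 1`, `u = 5^{2^{e−3}}`.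
Odd: `ψ₀` is even. Primitive: `ψ_j(u) = β(u)·ψ₀(u²)^j = −1` and `isPrimitive_of_apply_ne_one`. Injective: `ψ₀(5)` has order exactly `2^{e−2}`
(`ψ₀(5)^{2^{e−3}} = ψ₀(u) ≠ 1`, `ψ₀(5)^{2^{e−2}} = ψ₀(u²) = 1`), so `ψ₀^{2j} = ψ₀^{2j'}` forces `2^{e−2} ∣ 2(j − j')`. (There are exactly
`2^{e−3}` odd primitive characters modulo `2^e`; we only need this lower bound.) [cite: Washington1997, §7.2] -/
theorem exists_odd_isPrimitive_family {e : ℕ} (he : 3 ≤ e) [HasEnoughRootsOfUnity K (Nat.totient (2 ^ e))] :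
    ∃ ψ : Fin (2 ^ (e - 3)) → DirichletCharacter K (2 ^ e),
      Function.Injective ψ ∧ ∀ j, (ψ j).Odd ∧ (ψ j).IsPrimitive := by
  classical
  haveI : NeZero (2 ^ e) := ⟨pow_ne_zero _ two_ne_zero⟩
  obtain ⟨β, hβodd, hβu⟩ := exists_odd_apply_eq_neg_one K he
  obtain ⟨ψ₀, hψ₀ev, hψ₀u⟩ := exists_even_apply_ne_one K he
  have hcop5 : Nat.Coprime 5 (2 ^ e) := Nat.Coprime.pow_right _ (by norm_num)
  let γ : (ZMod (2 ^ e))ˣ := ZMod.unitOfCoprime 5 hcop5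
  have hγ : (γ : ZMod (2 ^ e)) = 5 := by rw [ZMod.coe_unitOfCoprime]; push_cast; rfl
  have hu5 : (((5 ^ 2 ^ (e - 3) : ℕ) : ZMod (2 ^ e))) = ((γ ^ 2 ^ (e - 3) : (ZMod (2 ^ e))ˣ) : ZMod (2 ^ e)) := by
    rw [Units.val_pow_eq_pow_val, hγ]; push_cast; rfl
  -- the order of `ζ = ψ₀(5)`
  set ζ : K := ψ₀ (γ : ZMod (2 ^ e)) with hζ
  have hζpow : ∀ n : ℕ, ζ ^ n = ψ₀ (((γ ^ n : (ZMod (2 ^ e))ˣ) : ZMod (2 ^ e))) := fun n ↦ by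
    rw [hζ, Units.val_pow_eq_pow_val, map_pow]
  have hnot : ¬ ζ ^ 2 ^ (e - 3) = 1 := by rw [hζpow, ← hu5]; exact hψ₀u
  have hfin : ζ ^ 2 ^ (e - 3 + 1) = 1 := by
    rw [pow_succ, pow_mul, hζpow, ← hu5, ← map_pow]
    have : (((5 ^ 2 ^ (e - 3) : ℕ) : ZMod (2 ^ e))) ^ 2 = 1 := by push_cast; exact five_pow_sq_eq_one he
    rw [this, map_one]
  have hord : orderOf ζ = 2 ^ (e - 3 + 1) := orderOf_eq_prime_pow hnot hfin
  have hζ0 : ζ ≠ 0 := fun h0 ↦ by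
    rw [h0, zero_pow (pow_ne_zero _ two_ne_zero)] at hfin
    exact zero_ne_one hfin
  -- `ζ^{2a} = ζ^{2b}` with `a ≤ b < 2^{e-3}` forces `a = b`
  have key : ∀ a b : ℕ, a ≤ b → b < 2 ^ (e - 3) → ζ ^ (2 * a) = ζ ^ (2 * b) → a = b := by
    intro a b hab hb h
    have h1 : ζ ^ (2 * a) * (ζ ^ (2 * (b - a)) - 1) = 0 := by
      rw [mul_sub, mul_one, ← pow_add, show 2 * a + 2 * (b - a) = 2 * b by omega, h, sub_self]
    have h2 : ζ ^ (2 * (b - a)) = 1 := by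
      have := (mul_eq_zero.mp h1).resolve_left (pow_ne_zero _ hζ0)
      linear_combination this
    have h3 : 2 ^ (e - 3 + 1) ∣ 2 * (b - a) := hord ▸ orderOf_dvd_of_pow_eq_one h2
    have h4 : 2 * (b - a) = 0 := Nat.eq_zero_of_dvd_of_lt h3 (by rw [pow_succ]; omega)
    omega
  refine ⟨fun j ↦ β * ψ₀ ^ (2 * (j : ℕ)), ?_, fun j ↦ ⟨?_, ?_⟩⟩
  · -- injectivity
    intro j j' hjj'
    have h1 : ψ₀ ^ (2 * (j : ℕ)) = ψ₀ ^ (2 * (j' : ℕ)) := mul_left_cancel (a := β) hjj'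
    have h2 : ζ ^ (2 * (j : ℕ)) = ζ ^ (2 * (j' : ℕ)) := by
      have := congrArg (fun χ : DirichletCharacter K (2 ^ e) ↦ χ (γ : ZMod (2 ^ e))) h1
      simpa only [MulChar.pow_apply_coe] using this
    rcases Nat.le_total (j : ℕ) (j' : ℕ) with hle | hle
    · exact Fin.ext (key _ _ hle j'.2 h2)
    · exact Fin.ext (key _ _ hle j.2 h2.symm).symm
  · -- odd
    show (β * ψ₀ ^ (2 * (j : ℕ))) (-1) = -1
    rw [MulChar.mul_apply, ← Units.coe_neg_one, MulChar.pow_apply_coe, Units.coe_neg_one, hψ₀ev, one_pow, mul_one]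
    exact hβodd
  · -- primitive
    refine isPrimitive_of_apply_ne_one K he _ ?_
    rw [MulChar.mul_apply, hβu, hu5, MulChar.pow_apply_coe, pow_mul, ← map_pow, ← Units.val_pow_eq_pow_val, ← pow_mul,
      ← pow_succ, ← hζpow, hfin, one_pow, mul_one]
    exact fun h ↦ (NeZero.ne (2 : K)) (by linear_combination -h)

end Characters

end Summit.BirchSwinnertonDyer.BirchSwinnertonDyer.Theorems.SignedKatoOffTwo.OddTwistSupply

end
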